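import Mathlib
import Literature.MathematicalPhysics.QuantumFieldTheory.Balaban1983to89.B6RandomWalk

/-!
# `Balaban1983to89.B9Thm314ExtraFactor` — [Balaban1985BackgroundPropagators] Theorem 3.14 (pp. 426–427): *"their difference satisfies ALL the inequalities
# characteristic for operators of the considered type, with the additional factor exp(−δ₀d(y, y′, Ω))"* — the PROPAGATION of the additional factor through
# products of block-majorised operators ([4] (2.55) with an extra factor): if one factor of a product carries `e^{−δF}` for an `F` sub-additive along the
# multiscale distance (as (3.154)'s `d(y,y′,Ω)` is), the product carries `e^{−(δ/3)F}` — so the composite operators of the paper (R, P = I − R, Δ_a, G, H, C^{(k)})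
# inherit Theorem 3.14 from G′ and (Q′G′²Q′*)⁻¹ by algebra

B9 = T. Bałaban, *Propagators for lattice gauge theories in a background field*, Commun. Math. Phys. **99** (1985) 389–434 [Balaban1985BackgroundPropagators], Thm 3.14
(3.154) pp. 426–427; [4] = [Balaban1984PropagatorsII] (2.51)–(2.55) p. 232, Lemma 2.1 (2.61) p. 234.

WHY (DAG node N06, seat `pub-ymgap-dag-n06-a`; count-neutral [B9] supply for the pin's Thm-3.14 members and for `Thm314LocalPrinted`'s «all the inequalities»):
the resolvent engines `B9Thm314ResolventCore∕…Weighted` produce the extra factor for the PRIMARY differences G′[D] − G′[D′]; every other operator of the paper is a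
WORD in G′, Q′, (Q′G′²Q′*)⁻¹, … ((3.25) R = I − G′Q′*(Q′G′²Q′*)⁻¹Q′G′, (3.26) Δ_a, (3.126) H = GQ*(QGQ*)⁻¹, (3.185) C^{(k)}), and a difference of words telescopes
into words in which exactly one factor is a primary difference.  This file is the bookkeeping that carries the extra factor through such words.
SUB-ADDITIVITY OF (3.154): d(y, y′, Ω) ≤ d(y, y₁) + d(y₁, y′, Ω) and d(y, y′, Ω) ≤ d(y, y₁, Ω) + d(y₁, y′) (insert the triangle inequality into the infimum) —
displayed hypotheses `hFl`, `hFr` below.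

WHAT IS PROVED (kernel; no `sorry`; bookkeeping over `B6RandomWalk.HasMajorant`):
* `hasMajorant_mul_extra_right` — `K₁ ≤ C₁w(a)e^{−δd}` times `0 ≤ K₂ ≤ C₂r(b)e^{−δd(y,b)}e^{−δF(y,b)}` with `F(a,b) ≤ d(a,y) + F(y,b)` and (2.61) at rate δ/3 ⇒
  `T₁T₂` has majorant `C₁C₂c·w(a)r(b)·e^{−(δ/3)d(a,b)}·e^{−(δ/3)F(a,b)}`;
* `hasMajorant_mul_extra_left` — the mirror image (`K₁` carries the factor, `F(a,b) ≤ F(a,y) + d(y,b)`);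
* `mul_sub_mul_telescope`, `hasMajorant_mul_sub_mul_extra` — `T₁S₁ − T₂S₂ = (T₁ − T₂)S₁ + T₂(S₁ − S₂)`: a DIFFERENCE OF PRODUCTS inherits the factor when the
  two primary differences carry it (constants `(C_ΔT·C_S + C_T·C_ΔS)·c`).
HONEST SCOPE: weights only at the outer variables (middle weights need the (2.60) transfer of `B9Thm314ResolventWeighted`); one block structure; count-neutral; NOT
continuum ∕ Clay.
-/

namespace Literature.MathematicalPhysics.QuantumFieldTheory.Balaban1983to89.B9Thm314ExtraFactor

open Finset
open Literature.MathematicalPhysics.QuantumFieldTheory.Balaban1983to89.B6RandomWalk (HasMajorant hasMajorant_mono hasMajorant_mul Triangle254)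

variable {g : B6.Geometry} {X : Type}

/-- **[4] (2.55) with an extra factor on the RIGHT factor**: the product inherits `e^{−(δ/3)F}` when `F` is sub-additive on the left along `d`.
[cite: Balaban1985BackgroundPropagators, Thm 3.14 (3.154) pp.426–427 («all the inequalities characteristic … with the additional factor», bookkeeping); Balaban1984PropagatorsII, (2.55) p.232] -/
theorem hasMajorant_mul_extra_right (blk : X → g.Site) (hd : ∀ a b : g.Site, 0 ≤ g.dist a b) (htri : Triangle254 g)
    {δ c C₁ C₂ : ℝ} (hδ : 0 ≤ δ) (hC₁ : 0 ≤ C₁) (hC₂ : 0 ≤ C₂)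
    (hsum : ∀ y : g.Site, ∑ y' : g.Site, Real.exp (-(δ / 3 * g.dist y y')) ≤ c)
    (F : g.Site → g.Site → ℝ) (hF0 : ∀ a b, 0 ≤ F a b) (hFl : ∀ a y b : g.Site, F a b ≤ g.dist a y + F y b)
    (w r : g.Site → ℝ) (hw : ∀ a, 0 ≤ w a) (hr : ∀ b, 0 ≤ r b)
    {T₁ T₂ : Module.End ℝ (X → ℝ)} {K₁ K₂ : g.Site → g.Site → ℝ} (h₁ : HasMajorant blk T₁ K₁) (h₂ : HasMajorant blk T₂ K₂)
    (hK₂0 : ∀ a b, 0 ≤ K₂ a b) (hK₁ : ∀ a y : g.Site, K₁ a y ≤ C₁ * w a * Real.exp (-(δ * g.dist a y)))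
    (hK₂ : ∀ y b : g.Site, K₂ y b ≤ C₂ * r b * Real.exp (-(δ * g.dist y b)) * Real.exp (-(δ * F y b))) :
    HasMajorant blk (T₁ * T₂)
      (fun a b => C₁ * C₂ * c * w a * r b * Real.exp (-(δ / 3 * g.dist a b)) * Real.exp (-(δ / 3 * F a b))) := by
  refine hasMajorant_mono blk (hasMajorant_mul blk h₁ h₂ hK₂0) fun a b => ?_
  set E : ℝ := Real.exp (-(δ / 3 * g.dist a b)) * Real.exp (-(δ / 3 * F a b)) with hE
  have hE0 : 0 ≤ E := mul_nonneg (Real.exp_nonneg _) (Real.exp_nonneg _)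
  have hP : 0 ≤ C₁ * C₂ * w a * r b := mul_nonneg (mul_nonneg (mul_nonneg hC₁ hC₂) (hw a)) (hr b)
  have hterm : ∀ y : g.Site, K₁ a y * K₂ y b ≤ C₁ * C₂ * w a * r b * E * Real.exp (-(δ / 3 * g.dist a y)) := by
    intro y
    have t1 : K₁ a y * K₂ y b ≤ (C₁ * w a * Real.exp (-(δ * g.dist a y))) *
        (C₂ * r b * Real.exp (-(δ * g.dist y b)) * Real.exp (-(δ * F y b))) :=
      mul_le_mul (hK₁ a y) (hK₂ y b) (hK₂0 _ _) (mul_nonneg (mul_nonneg hC₁ (hw a)) (Real.exp_nonneg _))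
    have hexp : Real.exp (-(δ * g.dist a y)) * (Real.exp (-(δ * g.dist y b)) * Real.exp (-(δ * F y b))) ≤
        E * Real.exp (-(δ / 3 * g.dist a y)) := by
      rw [hE, ← Real.exp_add, ← Real.exp_add, ← Real.exp_add, ← Real.exp_add]
      apply Real.exp_le_exp.2
      have hab := htri a y b
      have hFab := hFl a y b
      have h1 := hd a y
      have h2 := hd y b
      have h3 := hF0 y b
      have h4 : δ / 3 * (g.dist a b + F a b + g.dist a y) ≤ δ / 3 * (3 * g.dist a y + g.dist y b + F y b) :=
        mul_le_mul_of_nonneg_left (by linarith) (by linarith)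
      nlinarith
    calc K₁ a y * K₂ y b ≤ (C₁ * w a * Real.exp (-(δ * g.dist a y))) *
          (C₂ * r b * Real.exp (-(δ * g.dist y b)) * Real.exp (-(δ * F y b))) := t1
      _ = C₁ * C₂ * w a * r b * (Real.exp (-(δ * g.dist a y)) * (Real.exp (-(δ * g.dist y b)) * Real.exp (-(δ * F y b)))) := by
          ring
      _ ≤ C₁ * C₂ * w a * r b * (E * Real.exp (-(δ / 3 * g.dist a y))) := mul_le_mul_of_nonneg_left hexp hP
      _ = C₁ * C₂ * w a * r b * E * Real.exp (-(δ / 3 * g.dist a y)) := by ring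
  calc ∑ y : g.Site, K₁ a y * K₂ y b ≤ ∑ y : g.Site, C₁ * C₂ * w a * r b * E * Real.exp (-(δ / 3 * g.dist a y)) :=
        Finset.sum_le_sum fun y _ => hterm y
    _ = C₁ * C₂ * w a * r b * E * ∑ y : g.Site, Real.exp (-(δ / 3 * g.dist a y)) := by rw [Finset.mul_sum]
    _ ≤ C₁ * C₂ * w a * r b * E * c := mul_le_mul_of_nonneg_left (hsum a) (mul_nonneg hP hE0)
    _ = C₁ * C₂ * c * w a * r b * Real.exp (-(δ / 3 * g.dist a b)) * Real.exp (-(δ / 3 * F a b)) := by rw [hE]; ring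

/-- **[4] (2.55) with an extra factor on the LEFT factor**: the product inherits `e^{−(δ/3)F}` when `F` is sub-additive on the right along `d`.
[cite: Balaban1985BackgroundPropagators, Thm 3.14 (3.154) pp.426–427 (bookkeeping); Balaban1984PropagatorsII, (2.55) p.232] -/
theorem hasMajorant_mul_extra_left (blk : X → g.Site) (hd : ∀ a b : g.Site, 0 ≤ g.dist a b) (htri : Triangle254 g)
    {δ c C₁ C₂ : ℝ} (hδ : 0 ≤ δ) (hC₁ : 0 ≤ C₁) (hC₂ : 0 ≤ C₂)
    (hsum : ∀ y : g.Site, ∑ y' : g.Site, Real.exp (-(δ / 3 * g.dist y' y)) ≤ c)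
    (F : g.Site → g.Site → ℝ) (hF0 : ∀ a b, 0 ≤ F a b) (hFr : ∀ a y b : g.Site, F a b ≤ F a y + g.dist y b)
    (w r : g.Site → ℝ) (hw : ∀ a, 0 ≤ w a) (hr : ∀ b, 0 ≤ r b)
    {T₁ T₂ : Module.End ℝ (X → ℝ)} {K₁ K₂ : g.Site → g.Site → ℝ} (h₁ : HasMajorant blk T₁ K₁) (h₂ : HasMajorant blk T₂ K₂)
    (hK₂0 : ∀ a b, 0 ≤ K₂ a b)
    (hK₁ : ∀ a y : g.Site, K₁ a y ≤ C₁ * w a * Real.exp (-(δ * g.dist a y)) * Real.exp (-(δ * F a y)))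
    (hK₂ : ∀ y b : g.Site, K₂ y b ≤ C₂ * r b * Real.exp (-(δ * g.dist y b))) :
    HasMajorant blk (T₁ * T₂)
      (fun a b => C₁ * C₂ * c * w a * r b * Real.exp (-(δ / 3 * g.dist a b)) * Real.exp (-(δ / 3 * F a b))) := by
  refine hasMajorant_mono blk (hasMajorant_mul blk h₁ h₂ hK₂0) fun a b => ?_
  set E : ℝ := Real.exp (-(δ / 3 * g.dist a b)) * Real.exp (-(δ / 3 * F a b)) with hE
  have hE0 : 0 ≤ E := mul_nonneg (Real.exp_nonneg _) (Real.exp_nonneg _)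
  have hP : 0 ≤ C₁ * C₂ * w a * r b := mul_nonneg (mul_nonneg (mul_nonneg hC₁ hC₂) (hw a)) (hr b)
  have hterm : ∀ y : g.Site, K₁ a y * K₂ y b ≤ C₁ * C₂ * w a * r b * E * Real.exp (-(δ / 3 * g.dist y b)) := by
    intro y
    have t1 : K₁ a y * K₂ y b ≤ (C₁ * w a * Real.exp (-(δ * g.dist a y)) * Real.exp (-(δ * F a y))) *
        (C₂ * r b * Real.exp (-(δ * g.dist y b))) :=
      mul_le_mul (hK₁ a y) (hK₂ y b) (hK₂0 _ _)
        (mul_nonneg (mul_nonneg (mul_nonneg hC₁ (hw a)) (Real.exp_nonneg _)) (Real.exp_nonneg _))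
    have hexp : Real.exp (-(δ * g.dist a y)) * Real.exp (-(δ * F a y)) * Real.exp (-(δ * g.dist y b)) ≤
        E * Real.exp (-(δ / 3 * g.dist y b)) := by
      rw [hE, ← Real.exp_add, ← Real.exp_add, ← Real.exp_add, ← Real.exp_add]
      apply Real.exp_le_exp.2
      have hab := htri a y b
      have hFab := hFr a y b
      have h1 := hd a y
      have h2 := hd y b
      have h3 := hF0 a y
      have h4 : δ / 3 * (g.dist a b + F a b + g.dist y b) ≤ δ / 3 * (g.dist a y + 3 * g.dist y b + F a y) :=
        mul_le_mul_of_nonneg_left (by linarith) (by linarith)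
      nlinarith
    calc K₁ a y * K₂ y b ≤ (C₁ * w a * Real.exp (-(δ * g.dist a y)) * Real.exp (-(δ * F a y))) *
          (C₂ * r b * Real.exp (-(δ * g.dist y b))) := t1
      _ = C₁ * C₂ * w a * r b * (Real.exp (-(δ * g.dist a y)) * Real.exp (-(δ * F a y)) * Real.exp (-(δ * g.dist y b))) := by
          ring
      _ ≤ C₁ * C₂ * w a * r b * (E * Real.exp (-(δ / 3 * g.dist y b))) := mul_le_mul_of_nonneg_left hexp hP
      _ = C₁ * C₂ * w a * r b * E * Real.exp (-(δ / 3 * g.dist y b)) := by ring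
  calc ∑ y : g.Site, K₁ a y * K₂ y b ≤ ∑ y : g.Site, C₁ * C₂ * w a * r b * E * Real.exp (-(δ / 3 * g.dist y b)) :=
        Finset.sum_le_sum fun y _ => hterm y
    _ = C₁ * C₂ * w a * r b * E * ∑ y : g.Site, Real.exp (-(δ / 3 * g.dist y b)) := by rw [Finset.mul_sum]
    _ ≤ C₁ * C₂ * w a * r b * E * c := mul_le_mul_of_nonneg_left (hsum b) (mul_nonneg hP hE0)
    _ = C₁ * C₂ * c * w a * r b * Real.exp (-(δ / 3 * g.dist a b)) * Real.exp (-(δ / 3 * F a b)) := by rw [hE]; ring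

/-- The telescoping identity for a difference of products: `T₁S₁ − T₂S₂ = (T₁ − T₂)S₁ + T₂(S₁ − S₂)` (any ring).
[cite: Balaban1985BackgroundPropagators, Thm 3.14 p.427 («pair of operators constructed for the two sequences», bookkeeping)] -/
theorem mul_sub_mul_telescope {R : Type*} [Ring R] (t₁ t₂ s₁ s₂ : R) : t₁ * s₁ - t₂ * s₂ = (t₁ - t₂) * s₁ + t₂ * (s₁ - s₂) := by
  rw [sub_mul, mul_sub]; abel

/-- **A DIFFERENCE OF PRODUCTS inherits the additional factor**: if `T₁ − T₂` and `S₁ − S₂` carry `e^{−δF}` (their majorants from the resolvent engines) and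
`T₂`, `S₁` have plain exponential majorants, then `T₁S₁ − T₂S₂` carries `e^{−(δ/3)F}` — the product step of «all the inequalities characteristic for operators of the
considered type, with the additional factor». [cite: Balaban1985BackgroundPropagators, Thm 3.14 (3.154) pp.426–427 (bookkeeping); Balaban1984PropagatorsII, (2.55) p.232] -/
theorem hasMajorant_mul_sub_mul_extra (blk : X → g.Site) (hd : ∀ a b : g.Site, 0 ≤ g.dist a b) (htri : Triangle254 g)
    {δ c CT CS CΔT CΔS : ℝ} (hδ : 0 ≤ δ) (hCT : 0 ≤ CT) (hCS : 0 ≤ CS) (hCΔT : 0 ≤ CΔT) (hCΔS : 0 ≤ CΔS)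
    (hsum : ∀ y : g.Site, ∑ y' : g.Site, Real.exp (-(δ / 3 * g.dist y y')) ≤ c)
    (hsum' : ∀ y : g.Site, ∑ y' : g.Site, Real.exp (-(δ / 3 * g.dist y' y)) ≤ c)
    (F : g.Site → g.Site → ℝ) (hF0 : ∀ a b, 0 ≤ F a b) (hFl : ∀ a y b : g.Site, F a b ≤ g.dist a y + F y b)
    (hFr : ∀ a y b : g.Site, F a b ≤ F a y + g.dist y b)
    (w r : g.Site → ℝ) (hw : ∀ a, 0 ≤ w a) (hr : ∀ b, 0 ≤ r b)
    {T₁ T₂ S₁ S₂ : Module.End ℝ (X → ℝ)} {KΔT KT₂ KS₁ KΔS : g.Site → g.Site → ℝ}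
    (hΔT : HasMajorant blk (T₁ - T₂) KΔT) (hT₂ : HasMajorant blk T₂ KT₂) (hS₁ : HasMajorant blk S₁ KS₁) (hΔS : HasMajorant blk (S₁ - S₂) KΔS)
    (hKS₁0 : ∀ a b, 0 ≤ KS₁ a b) (hKΔS0 : ∀ a b, 0 ≤ KΔS a b)
    (hKΔT : ∀ a y : g.Site, KΔT a y ≤ CΔT * w a * Real.exp (-(δ * g.dist a y)) * Real.exp (-(δ * F a y)))
    (hKT₂ : ∀ a y : g.Site, KT₂ a y ≤ CT * w a * Real.exp (-(δ * g.dist a y)))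
    (hKS₁ : ∀ y b : g.Site, KS₁ y b ≤ CS * r b * Real.exp (-(δ * g.dist y b)))
    (hKΔS : ∀ y b : g.Site, KΔS y b ≤ CΔS * r b * Real.exp (-(δ * g.dist y b)) * Real.exp (-(δ * F y b))) :
    HasMajorant blk (T₁ * S₁ - T₂ * S₂)
      (fun a b => (CΔT * CS + CT * CΔS) * c * w a * r b * Real.exp (-(δ / 3 * g.dist a b)) * Real.exp (-(δ / 3 * F a b))) := by
  have h1 := hasMajorant_mul_extra_left blk hd htri hδ hCΔT hCS hsum' F hF0 hFr w r hw hr hΔT hS₁ hKS₁0 hKΔT hKS₁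
  have h2 := hasMajorant_mul_extra_right blk hd htri hδ hCT hCΔS hsum F hF0 hFl w r hw hr hT₂ hΔS hKΔS0 hKT₂ hKΔS
  rw [mul_sub_mul_telescope]
  refine hasMajorant_mono blk (B6RandomWalk.hasMajorant_add blk h1 h2) fun a b => le_of_eq ?_
  ring

end Literature.MathematicalPhysics.QuantumFieldTheory.Balaban1983to89.B9Thm314ExtraFactor
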